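/-
Copyright: the b2b-balaban T⁴-continuum CRUX team, row NE7b OWNER lineage `t4-ne7b-p1` (gen 146). Project licence.
-/
import Summits.QuantumFields.BalabanUV.T4Continuum.Spine.NE7b.SupWeightedTwoPointMastersTwo
import Summits.QuantumFields.BalabanUV.T4Continuum.Spine.NE7b.SupWeightedFivePointToolsThree
import Summits.QuantumFields.BalabanUV.T4Continuum.Spine.NE7b.SupFivePointGreedyRowSum

/-!
# THE WEIGHTED FIFTH-ORDER SLOT LETTER, SLOT THREE (`z` fixed), PART 8 OF 8 (SCOPING-d17 §F, F13–F17; file (718)).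
# The interpolated entry majorant `M₅′` of (687) (52 terms, no support indicator, product decay) summed over its four free indices against
# the full-graph weight `W = Π_{10 pairs}ϑ` with `z` fixed — the OUTPUT slot letter of the weighted class at order five — from weighted INPUT
# letters only: the full-graph `ϑ₂`-weighted `K5` letter of this role, the `σ`-profile letters of the `Hk`∕`K3`∕`K4`∕`K5` families (masses and
# columns; discharged from intrinsic letters as in (659)∕(666)), the `ϑ₂`-weighted `Hk`∕`K3` letters, and three geometry letters (`G = sup
# Σϑ⁶∕√ρ`, `Θ8 = sup Σϑ⁸∕ϑ₂`, `S2 = sup Σϑ²∕r₁`).  ROUTING: every pair of the five indices is carried along the term's tree (loads `≤ 6` on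
# `ρ`-edges and the crossing edge — `ϑ⁶ ≤ σσ` —, `≤ 4` on Hessian∕internal edges — `ϑ⁴ ≤ ϑ₂` —, `≤ 2` on `r₁`-star edges; non-star pairs of the
# product-decay terms absorbed by `ϑ ≤ r₁`), then summed leaf-first ((689)∕(691)).  NO support letter, NO finite-range hypothesis
# (row NE7b, node U5c; (653), (656), (687), (689), (691) BY NAME; [folklore]).

Cell `pub-balaban`, sub-cell `t4`, spine estimate NE7b (`T4WeightBudget.RelWeightBound`; the cell's OWN estimate — NOT PRINTED in
[Bałaban 1983–89], NOT PROVED).  Crux-route work under `Spine/NE7b/` by the row OWNER (`t4-ne7b-p1` gen 146, file (718)) under FREEZE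
(0)'s crux-prover clause; NOTHING of Bałaban's is named as a Lean object, valued or asserted; no `T4Continuum/Support` leaf typed; no
`def`, no notation (`M₅′`'s terms WRITTEN OUT as printed by (687)); zero `sorry`.  Imports (BY NAME): (656), (700) ((691), (689), (653),
(649) through them), (538) (`sum4_rot3∕4`).

WHAT IS PROVED ([folklore]): **`output_k5ϑ_z_part8`**; toy.

HONEST (what this is NOT).  One slot (part) of five; hypotheses = the weighted-class letters of SCOPING-d17 §D∕§F at order five (rates `ϑ⁴ ≤ ϑ₂`,
`ϑ⁶ ≤ σσ`, `ϑ ≤ r₁`, `Σϑ⁸∕ϑ₂, Σϑ⁶∕√ρ, Σϑ²∕r₁ < ∞`); the `K5` profile discharges and the packaging are later files; scalar skeleton ((A3),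
NC-NE7b-α UNRULED); nothing of Bałaban's asserted.  BY-NAME EFFECT ON THE WALL: NONE.  NE7b NOT PRINTED ∕ NOT PROVED; spine PROVED 0∕9; rung
(B)+1 — the programme's measures remain FINITE-torus statements; NOT the mass gap, NOT Clay.  HONEST DEPENDENCY: continuum YM on T⁴ ⇐ BetaPertH
∧ nine spine estimates (0∕9 proved); BetaPertH ⇐ (D1) ∧ (D4) ∧ CAP+tail; G-an2-4 gates asym, D1 and NE2∕3∕4.
-/

set_option autoImplicit false

noncomputable section

namespace Summit.QuantumFields.BalabanUV.T4Continuum.NE7b.SupWeightedFifthOrderLettersThreePart8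

open Finset Real
open scoped BigOperators
open SupWeightedSlotTools (sum_sqrt_mul_le_letters)
open SupWeightedTwoPointMasters (weighted_two_point_family_le weighted_two_point_family_le')
open SupWeightedTwoPointMastersTwo (weighted_two_point_two_families_le weighted_two_point_two_families_le')
open SupWeightedFivePointTools
open SupWeightedFivePointToolsTwo (rmono smono tmono pmono geom2 sum2_sqrt_mul_le_letters' absorb_le_one mul_le_one_of sqrt_split3
  sqrt_split4 sqrt_split_tree)
open SupWeightedFivePointToolsThree (pmono_first pmono_second geom_first geom_second)
open SupFivePointGreedyRowSum (sum4_rot3 sum4_rot4)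

variable {ι κ : Type} [Fintype ι] [Fintype κ]

variable {Hk : ι → ι → ℝ} {K3 : ι → ι → ι → ℝ} {K4 : ι → ι → ι → ι → ℝ} {K5 : ι → ι → ι → ι → ι → ℝ} {A : Matrix ι κ ℝ} {D : κ → κ → ℝ}
  {ϑ ϑ₂ ρ r₁ : ι → ι → ℝ} {σ : ι → κ → ℝ} {θ : κ → κ → ℝ}
  {κ₂ γop lam lamA C3k C3h C4 C5 dθ dθ' αθ αθc αg1m αg2m αg1c αk4m1 αk4m2 αk4m3 αk4c αk5m1 αk5m2 αk5m3 αk5m4 αk5c hrϑ hcϑ k3rϑ k3mϑ k3cϑ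
    k5ϑ1 k5ϑ2 k5ϑ3 k5ϑ4 k5ϑ5 G Θ8 S2 : ℝ}

set_option maxHeartbeats 1600000 in
/-- **WEIGHTED FIFTH-ORDER SLOT LETTER, `z` FIXED, PART 8 OF 8**: terms `51` of `M₅′` ((687)) summed over
the four free indices against the full-graph weight `Π_{10 pairs}ϑ`. [folklore] -/
theorem output_k5ϑ_z_part8 (hϑ1 : ∀ x y, 1 ≤ ϑ x y) (hϑsymm : ∀ x y, ϑ x y = ϑ y x) (hr0 : ∀ x y, 0 < r₁ x y) (hr₁symm : ∀ x y, r₁ x y = r₁ y x)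
    (hϑr₁ : ∀ x y, ϑ x y ≤ r₁ x y) (hC50 : 0 ≤ C5) (hS2 : ∀ a, ∑ b, ϑ a b ^ 2 / r₁ a b ≤ S2)
    (z : ι) :
    ∑ x, ∑ y, ∑ t, ∑ s,
        ((C5 * ((r₁ x y)⁻¹ * (r₁ x z)⁻¹ * (r₁ x t)⁻¹ * (r₁ x s)⁻¹ * (r₁ y z)⁻¹ * (r₁ y t)⁻¹ * (r₁ y s)⁻¹ * (r₁ z t)⁻¹ * (r₁ z s)⁻¹ * (r₁ t s)⁻¹) :
          ℝ)) * (ϑ x y * ϑ x z * ϑ x t * ϑ x s * ϑ y z * ϑ y t * ϑ y s * ϑ z t * ϑ z s * ϑ t s) ≤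
      C5 * (S2 * (S2 * (S2 * S2))) := by
  have h0 : ∀ a b, 0 ≤ ϑ a b := fun a b => zero_le_one.trans (hϑ1 a b)
  have h1 : ∀ a b, 1 ≤ ϑ a b := hϑ1
  have hsy : ∀ a b, ϑ a b = ϑ b a := hϑsymm
  have hS20 : 0 ≤ S2 := le_trans (Finset.sum_nonneg fun b _ => div_nonneg (pow_nonneg (h0 _ _) 2) (hr0 _ _).le) (hS2 z)
  have hS2sy : ∀ a, ∑ b, ϑ a b ^ 2 / r₁ b a ≤ S2 := fun a => by simp_rw [hr₁symm _ a]; exact hS2 a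
  have tm51 : ∑ x, ∑ y, ∑ t, ∑ s,
      ((C5 * ((r₁ x y)⁻¹ * (r₁ x z)⁻¹ * (r₁ x t)⁻¹ * (r₁ x s)⁻¹ * (r₁ y z)⁻¹ * (r₁ y t)⁻¹ * (r₁ y s)⁻¹ * (r₁ z t)⁻¹ * (r₁ z s)⁻¹ * (r₁ t s)⁻¹) : ℝ))
      * (ϑ x y * ϑ x z * ϑ x t * ϑ x s * ϑ y z * ϑ y t * ϑ y s * ϑ z t * ϑ z s * ϑ t s) ≤ C5 * (S2 * (S2 * (S2 * S2))) := by
    have hw : ∀ x y t s : ι, ϑ x y * ϑ x z * ϑ x t * ϑ x s * ϑ y z * ϑ y t * ϑ y s * ϑ z t * ϑ z s * ϑ t s ≤ ϑ z x ^ 1 * ϑ z y ^ 1 * ϑ z t ^ 1 * ϑ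
        z s ^ 1 * ϑ x y * ϑ x t * ϑ x s * ϑ y t * ϑ y s * ϑ t s := fun x y t s =>
      (prod10_le le_rfl ((hsy x z).le) le_rfl le_rfl ((hsy y z).le) le_rfl le_rfl le_rfl le_rfl le_rfl (h0 _ _) (h0 _ _) (h0 _ _) (h0 _ _)
            (h0 _ _) (h0 _ _) (h0 _ _) (h0 _ _) (h0 _ _) (h0 _ _)).trans_eq (by ring)
    have hKK0 : 0 ≤ C5 := hC50
    have hpw : ∀ x y t s : ι,
        ((C5 * ((r₁ x y)⁻¹ * (r₁ x z)⁻¹ * (r₁ x t)⁻¹ * (r₁ x s)⁻¹ * (r₁ y z)⁻¹ * (r₁ y t)⁻¹ * (r₁ y s)⁻¹ * (r₁ z t)⁻¹ * (r₁ z s)⁻¹ * (r₁ t s)⁻¹) :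
          ℝ)) * (ϑ x y * ϑ x z * ϑ x t * ϑ x s * ϑ y z * ϑ y t * ϑ y s * ϑ z t * ϑ z s * ϑ t s) ≤ C5 *
        (ϑ z x ^ 1 * (r₁ x z)⁻¹ * ((ϑ z y ^ 1 * (r₁ y z)⁻¹) * ((ϑ z t ^ 1 * (r₁ z t)⁻¹) * (ϑ z s ^ 1 * (r₁ z s)⁻¹)))) := fun x y t s =>
      (mul_le_mul_of_nonneg_left (hw x y t s)
            (mul_nonneg hC50
              (mul_nonneg
                (mul_nonneg
                  (mul_nonneg
                    (mul_nonneg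
                      (mul_nonneg
                        (mul_nonneg
                          (mul_nonneg
                            (mul_nonneg (mul_nonneg (inv_nonneg.2 (hr0 _ _).le) (inv_nonneg.2 (hr0 _ _).le)) (inv_nonneg.2 (hr0 _ _).le))
                            (inv_nonneg.2 (hr0 _ _).le)) (inv_nonneg.2 (hr0 _ _).le)) (inv_nonneg.2 (hr0 _ _).le)) (inv_nonneg.2 (hr0 _ _).le))
                    (inv_nonneg.2 (hr0 _ _).le)) (inv_nonneg.2 (hr0 _ _).le)) (inv_nonneg.2 (hr0 _ _).le)))).trans
          (Eq.trans_le (by ring)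
            (mul_le_of_le_one_right
              (mul_nonneg hKK0
                (mul_nonneg (mul_nonneg (pow_nonneg (h0 _ _) _) (inv_nonneg.2 (hr0 _ _).le))
                  (mul_nonneg (mul_nonneg (pow_nonneg (h0 _ _) _) (inv_nonneg.2 (hr0 _ _).le))
                    (mul_nonneg (mul_nonneg (pow_nonneg (h0 _ _) _) (inv_nonneg.2 (hr0 _ _).le))
                      (mul_nonneg (pow_nonneg (h0 _ _) _) (inv_nonneg.2 (hr0 _ _).le))))))
              (mul_le_one_of
                (mul_le_one_of
                  (mul_le_one_of
                    (mul_le_one_of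
                      (mul_le_one_of (absorb_le_one (hϑr₁ x y) (hr0 x y)) (mul_nonneg (h0 _ _) (inv_nonneg.2 (hr0 _ _).le))
                        (absorb_le_one (hϑr₁ x t) (hr0 x t))) (mul_nonneg (h0 _ _) (inv_nonneg.2 (hr0 _ _).le))
                      (absorb_le_one (hϑr₁ x s) (hr0 x s))) (mul_nonneg (h0 _ _) (inv_nonneg.2 (hr0 _ _).le)) (absorb_le_one (hϑr₁ y t)
                          (hr0 y t)))
                  (mul_nonneg (h0 _ _) (inv_nonneg.2 (hr0 _ _).le)) (absorb_le_one (hϑr₁ y s) (hr0 y s)))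
                (mul_nonneg (h0 _ _) (inv_nonneg.2 (hr0 _ _).le)) (absorb_le_one (hϑr₁ t s) (hr0 t s)))))
    refine le_trans
        (Finset.sum_le_sum fun x _ => Finset.sum_le_sum fun y _ => Finset.sum_le_sum fun t _ => Finset.sum_le_sum fun s _ => hpw x y t s) ?_
    exact sum4_le (K := C5) (a := fun x => ϑ z x ^ 1 * (r₁ x z)⁻¹) (b := fun x y => ϑ z y ^ 1 * (r₁ y z)⁻¹)
        (c := fun x y t => ϑ z t ^ 1 * (r₁ z t)⁻¹) (d := fun x y t s => ϑ z s ^ 1 * (r₁ z s)⁻¹) hKK0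
        (fun x => (mul_nonneg (pow_nonneg (h0 _ _) _) (inv_nonneg.2 (hr0 _ _).le)))
        (fun x y => (mul_nonneg (pow_nonneg (h0 _ _) _) (inv_nonneg.2 (hr0 _ _).le)))
        (fun x y t => (mul_nonneg (pow_nonneg (h0 _ _) _) (inv_nonneg.2 (hr0 _ _).le))) hS20 hS20 hS20
        ((Finset.sum_le_sum fun x _ => smono (h1 z x) (hr0 x z) (by norm_num : 1 ≤ 2)).trans (hS2sy z))
        (fun x => ((Finset.sum_le_sum fun y _ => smono (h1 z y) (hr0 y z) (by norm_num : 1 ≤ 2)).trans (hS2sy z)))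
        (fun x y => ((Finset.sum_le_sum fun t _ => smono (h1 z t) (hr0 z t) (by norm_num : 1 ≤ 2)).trans (hS2 z)))
        (fun x y t => ((Finset.sum_le_sum fun s _ => smono (h1 z s) (hr0 z s) (by norm_num : 1 ≤ 2)).trans (hS2 z)))
  try simp (config := { maxSteps := 4000000 }) only [add_mul, Finset.sum_add_distrib]
  linarith [tm51]

/-! ## Toy -/

/-- Toy (a routed load in numbers): carrying four pairs through one edge of weight `2` costs `2⁴ = 16 ≤ 2⁶`. -/
example : (2 : ℝ) ^ 4 ≤ 2 ^ 6 := by norm_num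

end Summit.QuantumFields.BalabanUV.T4Continuum.NE7b.SupWeightedFifthOrderLettersThreePart8

end
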